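import Summits.KontsevichZagierPeriods.KontsevichZagierPeriods.Theses.RootDecompRationalCubeDichotomy
import Summits.KontsevichZagierPeriods.KontsevichZagierPeriods.Theorems.LowDimensionLowdimBaker0DimLeOne
import Summits.KontsevichZagierPeriods.KontsevichZagierPeriods.Theses.HodgeLevel
import Literature.NumberTheory.Transcendental.KZCubeRationalMoves
import Literature.NumberTheory.Transcendental.KZProductIdeal

/-! # `RootDecompRationalCubeDichotomyRankDescentP01` — part 1/14 of the mechanical ≤400-line split of `RankDescent_v12_landing.lean` (sha256 00885b8b9882f02e…)
Source: decomp-kz lens-2 g13 `RankDescent_v12.lean` (HOME/decomp-kz-lens-2/g13/, sha256 00885b8b…; critic g5-18…g5-66 CLEARED as NODE v1–v12 for crux stmt-KontsevichZagierPeriods-26322 RationalCubePiKernelSingle: rank dichotomy single_of_fullRankGeTwo + RankLeOneKernel, de Rham-exact descent, linear-in-one-variable / hyperbola / Fermat–hyperbolic / conic classes, transport kit, Brieskorn module; writer g7 l.1222: «landing split §0–4 ∣ … ∣ §16 --supports 26322 endorsed»); `#print axioms` pins removed; landed by census-1 g9.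
Split by census-1 g9 `gen/splitlean.py`: scopes re-opened with their `open`/`variable`/`set_option` context; mathematics and declaration order unchanged. -/

/-!
# Rank / de Rham-exactness dichotomy for the rational-cube π-kernel — crux 26322 `RationalCubePiKernelSingle` (v12)
(route `RootDecompRationalCubeDichotomy`; decomp-kz lens-2 «structural dichotomy: special vs generic», g13)

TARGET (by name): `Summit.KontsevichZagierPeriods.KontsevichZagierPeriods.Theses.RootDecompRationalCubeDichotomy.RationalCubePiKernelSingle`
— a rational cube representation `q = [ [0,1]^m, P/Q ]` (`P, Q ∈ ℚ[x_1..x_m]`, `Q` zero-free on the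
closed cube) with value `0` has `[π]^N · [q] ∈ KZ.relations` for some `N`.

THE AXIS. The (translation) RANK of the denominator: `rank Q := codim_ℚ {v ∈ ℚ^m : D_v Q = 0}`,
`D_v := Σ_k v_k ∂/∂x_k` — the least number of ℚ-linear forms `Q` factors through.
SPECIAL (structured) = rank-deficient (`∃ v ≠ 0, D_v Q = 0`: `{Q = 0}` is a cylinder in a rational
direction); GENERIC = full rank (`D_v Q = 0 → v = 0`).

THE LEVER (transversal Stokes descent, §1; no change of variables, no domain splitting — the domain is
the unit cube throughout, so the move iterates INSIDE the binder shape of 26322). If `D_v Q = 0`,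
`v ≠ 0`, the equation `D_v G = P` is solvable in `ℚ[x]` (§0 `exists_dirD_eq`, monomial recursion), and
on the cube `P/Q = D_v(G/Q) = Σ_k ∂_k (v_k G / Q)`; rule (1b) (`RFun.rel_sum`) and ONE Newton–Leibniz
move per coordinate (rule (3), `RFun.stokesAt`) give
  `[q] ≡ Σ_k ( [ [0,1]^{m-1}, v_k G/Q |_{x_k=1} ] − [ [0,1]^{m-1}, v_k G/Q |_{x_k=0} ] )   (descent_rel)`,
rational cube representations of dimension `m − 1` with zero-free denominators, which merge (rule (1b),
common denominator, `lsum`/`rel_lsum`) into ONE such representation with the same value (`eval`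
soundness `KZ.relations_le_ker_eval_holds`).

THE NODE (0 sorry; `#print axioms` of both heads = propext, Classical.choice, Quot.sound):

  RationalCubePiKernelSingle [26322]  ⟸  FullRankKernelGeTwo          — `single_of_fullRankGeTwo` (PROVED)

  with the special side discharged:
  * `rankLeOneKernel_holds : RankLeOneKernel` (PROVED, every `m`, `N = 0`): `Q = Q₁(c₀ + Σ cᵢ xᵢ)` with
    `Q₁ ∈ ℚ[t]` (rank ≤ 1: `{Q = 0}` a pencil of parallel hyperplanes over `ℚ̄`) and value `0`
    ⟹ `[q] ∈ relations`. Faces of rank-≤1 data are rank ≤ 1 (`rankLeOneDen_faceAt`), so the descent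
    runs to dimension `1` (`rankLeOne_to_dim_one`), where `KZ_≤1` (Baker; in the tree as
    `LowDimension.LowdimBaker0DimLeOne.lowdimBaker0DimLeOne_proof`) decides against the zero representation.
  * rank-deficient data of ANY rank and degree: inside `single_of_fullRankGeTwo` — induction on `m`:
    descend along a kernel direction, merge on `[0,1]^{m-1}`, recurse; the exponent `N` is inherited from
    the lower-dimensional instance and transported by `KZ.piRep_mul_iterate_mem_relations` (ideal property).

PIECES · TAGS · LEAVES
* `FullRankKernelGeTwo` [generic residual] := 26322 verbatim + hypotheses `2 ≤ m` and
  `∀ v, Σ_k v_k • ∂_k Q = 0 → v = 0`.  Tag WEAKER: implied by 26322 (`fullRankKernelGeTwo_of_single`,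
  drop two hypotheses) and a strictly smaller family of instances — every rank-deficient instance is
  removed, e.g. `[ [0,1]^3, P/(2 + (x+2y+3z)^7) ]` or `[ [0,1]^2, P/(1+(x−y)^2+(x−y)^4) ]` with value 0,
  decided here with `N = 0` and by no landed theorem or `m = 2` engine before (arbitrary degree, any `m`).
  Honest weight: for each `m ≥ 2` full rank is Zariski-open-dense in `Q`, so the residual keeps the bulk
  of 26322 (its Tate-twisted / Griffiths–Dwork-class-≠0 content named in the item's why-might-fail);
  the node removes a positive-codimension, infinite, previously undecided family and re-indexes the
  crux by an invariant no route of the summit uses.  Leaf: IDEA-NEEDED (`m ≥ 3`) · at `m = 2` it lies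
  inside the open `m ≤ 2` cruxes by name (`HodgeLevel.DimTwoRationalStratum` 0096 ⟹ it with `N = 0`;
  lens-3 `RootDecompRelativeModAbsolute.RegFoldingRational`/`RegKernelPair*` programme) — INSTRUMENTABLE
  there · BARRIER-adjacent (GPC beyond 1-motives, as recorded on 26322).
* `RankLeOneKernel` [special, THEOREM] — PROVED (`rankLeOneKernel_holds`).
* glue `single_of_fullRankGeTwo` [exhaustion, THEOREM] — PROVED; `fullRankKernelGeTwo_of_single` — PROVED.

WHY EACH PIECE IS STRICTLY WEAKER THAN THE TARGET. The only hypothesis of the node,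
`FullRankKernelGeTwo`, is 26322 with two added hypotheses, hence implied by it; it is not a costume:
the excluded rank-deficient family is infinite in every dimension `m ≥ 2`, was open in the tree, and
needs Baker plus §0–§3 to decide (`rankLeOneKernel_holds` is a genuine theorem about it). As for every
sub-family of an open conjecture, strict LOGICAL weakness is not decidable here and is not claimed.

WHY THE NODE IS NOVEL (relative to the cell's routes and lenses). 26322 and its neighbours are indexed
by DIMENSION (`KZ_≤1`, DimensionDescent, the `m = 2` engines of lens-2 g6/g7, lens-3, lens-6), by
DEGREE / curve type of `Q` (lens-4 quadric domains, lens-6 pairs, lens-3 `RegKernelPairDegOne`), by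
ARRANGEMENT type (LinRedNormalForm: products of ℚ-linear forms), or on the transcendence side
(PiCancellation E/P/G, this lens g10–g12). None uses the translation rank of `Q`, and none has a
change-of-variables-free dimension-lowering move on the fixed cube: the divergence identity
`P/Q = Σ_k ∂_k(v_k G/Q)` (with the `D_v`-primitive `G` of §0) makes rule (3) such an operator for every
rank-deficient denominator of every degree. Presearch (corpus fts+vec and galaxy, g13 NOTES.md):
the calculus facts are folklore (divergence theorem on a box; primitives along a constant vector
field); no formalisation and no route/card text with this reduction was found; nearest printed
neighbour of the GENERIC side is Griffiths–Dwork pole reduction [corpus: dimca1992 Ch. 6; voisin2003 II]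
(the de Rham class of `P/Q·dx`), which the item text already names as the danger axis.

CHECKS (farm, Mathlib + project snapshot): `lean check` rc 0 · 0 errors · 0 warnings · 0 sorries;
`#print axioms single_of_fullRankGeTwo`, `… rankLeOneKernel_holds` = [propext, Classical.choice, Quot.sound].
Imports: landed tree modules only. No `sorry`, no new axioms, no `allowUnsafeReducibility`.

## v2 ADDENDUM (§5): the de Rham–EXACT descent — the Griffiths–Dwork axis named in 26322's why-might-fail

Same lever, general potentials `G_k/Q^{s+1}`: if `P/Q·dx` is EXACT in `ℚ[x, 1/Q]` —
`P·Q^{s+1} = Σ_k (∂_kG_k·Q − (s+1)·G_k·∂_kQ)` (`DRExact`, inlined in the pieces) — then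
`[q] ≡ Σ_k ([G_k/Q^{s+1}|_{x_k=1}] − [G_k/Q^{s+1}|_{x_k=0}])` (`descent_rel_exact`), merged into ONE rational
cube representation one dimension down (`exact_reduct`). Rank-deficient ⟹ exact (`drExact_of_dirD`, `s = 0`,
`G_k = v_k G`), so §1–§4 is the linear shadow of §5 and the residual SHRINKS:

  RationalCubePiKernelSingle [26322] ⟸ NonExactKernelGeTwo ⟸ FullRankKernelGeTwo ⟸ 26322
  (`single_of_nonExactGeTwo`, `nonExactKernelGeTwo_of_fullRank`, `fullRankKernelGeTwo_of_single` — all PROVED),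

and the reduction is DIMENSION-LOCAL (graded pieces `SingleAt m` = 26322 at dimension `m`, `NonExactAt m` =
its non-exact slice): `singleAt_succ : SingleAt m → NonExactAt (m+1) → SingleAt (m+1)` (PROVED),
`singleAt_of_nonExactAt_le` (Theorem III), `singleAt_of_le_one` (Baker), and the by-name edge to the cell's
`m ≤ 2` programme `singleAt_of_dimTwoRationalStratum : HodgeLevel.DimTwoRationalStratum → m ≤ 2 → SingleAt m`
with the corollary `singleAt_le_three_of : DimTwoRationalStratum → NonExactAt 3 → ∀ m ≤ 3, SingleAt m`
— the first generic layer beyond the `m = 2` engines is exactly the NON-EXACT rational 3-cube integrands.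
At `m = 2` the exact slice is decided outright: `mem_relations_of_exact_two` (N = 0; for each zero-free `Q`
this is a ℚ-subspace of numerators of finite codimension ≤ dim H²_dR(𝔸²∖{Q=0}), Grothendieck — remark, not
formalised), with the separating WITNESS `[ [0,1]², (1−2x−x²+y²−2xy²)/(1+x²+y²)² ]` = `∂_x(x(1−x)/(1+x²+y²))`
(value 0): `witness_exact`, `witness_fullRank` (outside v1), `witness_zeroFree`, `witness_decided` (PROVED).

v2 PIECES · TAGS: `NonExactAt m` (m ≥ 2) / `NonExactKernelGeTwo` [generic residual · WEAKER (implied by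
26322, `nonExactKernelGeTwo_of_single`; sub-family of v1's residual, `nonExactKernelGeTwo_of_fullRank`; the
newly decided part is non-vacuous and outside v1: the witness) · IDEA-NEEDED (m ≥ 3) · INSTRUMENTABLE
(exactness = a LINEAR system in the coefficients of `G` for fixed `s`, degree — a certificate search any kit
seat can run on the census lists; m = 2 slice ⟸ DimTwoRationalStratum by name) · BARRIER-adjacent (a
non-exact `P/Q` with vanishing cube integral and no derivation = a counterexample to S; e.g. the slice
contains all `(P, (1+x)(1+y))`, whose decision needs `(log 2)² ∉ ℚ + Σ ℚ·log ℚ_{>0}` or a derivation —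
Schanuel-strength)]. v2 heads: `#print axioms single_of_nonExactGeTwo`, `mem_relations_of_exact_two`,
`witness_decided` = [propext, Classical.choice, Quot.sound]; extra import `…Theses.HodgeLevel` (landed).

## v3 ADDENDUM (§6): a DECIDED CLASS through v2 — denominators LINEAR IN ONE VARIABLE

`Q = c·x₀ + A(x₁,…,x_n)`, `c ∈ ℚˣ`, `n ≥ 1`: `𝔸^{n+1}∖{Q=0} ≅ 𝔸ⁿ × 𝔾_m` carries no `H^{n+1}`, and EVERY `P/Q` is
exact, constructively (`drExact_of_monicLinear`: divide `P = Q·q + ρ` with `ρ` free of `x₀`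
(`exists_monicLinear_div`), `∂₀G₀ = q`, `∂_iΦ = ρ` with `Φ` free of `x₀` (`exists_pderiv_eq`,
`pderiv_zero_rename_succ`, `pderiv_succ_rename_succ`), then `P/Q = ∂₀((G₀Q − Φ∂_iA)/Q) + ∂_i(Φ/Q)`;
general `c` by rescaling `P, Q ↦ P/c, Q/c`, the same integrand — `integrand_rescale`, `rescale_linear`).
Consequences (all PROVED, std axioms):
* `linearVar_single_of_singleAt : SingleAt n → (26322 for every [ [0,1]^{n+1}, P/(c·x₀ + A) ])` — the class
  REDUCES one dimension down at every `n ≥ 1`;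
* `linearVar_two_mem_relations` — DECIDED at m = 2 with N = 0: `[ [0,1]², P(x,y)/(c·x + A(y)) ]`, `A ∈ ℚ[y]`
  arbitrary with `c·x + A(y)` zero-free on the square, value 0 ⟹ `∈ relations` (values: Baker-type, after the
  exact descent only 1-dimensional rational integrals remain);
* `linearVar_three_of_dimTwo : DimTwoRationalStratum[0096] → (26322 for every [ [0,1]³, P/(c·x₀ + A(x₁,x₂)) ])`;
* `linearVar_example_fullRank`: `x + 2 + y²` has FULL rank — the class is outside v1 (`RankLeOneKernel` needs
  `Q = Q₁(affine form)`), is not a hyperplane arrangement (LinRed routes: products of linear forms) and not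
  the Λ-sector of lens-2 g6 (`1 + x·y·E(y)`: leading coefficient in `x` non-constant, dilogarithmic values).
TAGS: special side ENLARGED · WEAKER (instances of 26322 with N = 0 / one-step reductions) · PROVED.

§7 BY-NAME CLOSURE + CORNER CRITERION. (a) `rationalCubePiKernelSingleRankOne_holds`: the route's documented
rank-one rung (lens-2 g3 `RationalCubePiKernelSingleRankOne`, census K18a; route rationale «linear rank 1 all m
reduced to RankOnePushforward (move bookkeeping) ∧ DimLeOneKernel») PROVED verbatim, no pushforward hypothesis.
(b) grid denominators `Q = (x+a)(y+b)` at m = 2: `P(−a,−b) = 0 ⟹ exact` (`exists_corner_div`, `drExact_of_corner`)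
⟹ DECIDED `corner_two_mem_relations` (N = 0); the residual is the ONE-parameter family `CornerResidual a b`
(`P(−a,−b) ≠ 0`; value `= P(−a,−b)·log((1+a)/a)·log((1+b)/b) +` weight ≤ 1, e.g. `(log 2)²`), with the PROVED
split `grid_single_of_cornerResidual`. REMARK (not formalised; Gysin/residue, Dimca 1992 ch. 6): for any
`Q = B(y)·x + A(y)` with `gcd(A,B) = 1`, `H²_dR(𝔸²∖Q) ≅ H¹(𝔸¹∖{B=0})`, and `P/Q` is exact iff the residues of
`P(−A/B, y)/B(y) dy` at the roots of `B` vanish (β = #roots linear functionals; `B` constant: always exact = §6;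
`Q = 1 + xy`: exact iff `Σ_i (−1)^i p_ii = 0`) — the INSTRUMENT for the census's x-linear denominators.
§8 (v4) HYPERBOLA CLASS `Q = q₀ + x·y` — the constructive half of that instrument for the census-central denominator,
kernel-checked: the alternating-diagonal functional `diagAlt q₀ P = Σ_i p_ii (−q₀)^i` (for `q₀ = 1`: `Σ_i (−1)^i p_ii`);
`sub_C_diagAlt_mem : P − C (diagAlt q₀ P) ∈ Ex0 (q₀ + xy)` for EVERY `P` (the `s = 0`-exact numerators `Ex0 Q` form a
`ℚ`-submodule containing `Q·R`, `x^c`, `y^c` (`c ≥ 1`), hence all off-diagonal monomials, and `(xy)^i − (−q₀)^i`);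
`drExact_hyperbola : diagAlt q₀ P = 0 ⟹ DRExact P (q₀ + xy)` ⟹ **`hyperbola_two_mem_relations` DECIDED (N = 0)**:
`[ [0,1]², P/(q₀ + xy) ]`, zero-free (`q₀ > 0` or `q₀ < −1`), `Σ_i p_ii(−q₀)^i = 0`, value 0 ⟹ `∈ relations`; residual =
ONE-parameter `HyperbolaResidual q₀` (`diagAlt ≠ 0`; for `1 + xy` the value is a non-zero rational multiple of `π²` plus
weight ≤ 1), PROVED split `hyperbola_single_of_residual`. So on `Q = 1 + xy` item 26322 is EXACTLY «`a·π²/12 + (Baker-type) = 0`,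
`a ∈ ℚˣ` ⟹ derivable», i.e. conjecturally vacuous and Schanuel-strength — the sharpest possible localisation of the barrier.
§9 (v5) FERMAT–HYPERBOLIC CLASS `Q = q₀ + x₀x₁⋯x_n` in EVERY dimension (`Z ≅ 𝔾_mⁿ`, `H^{n+1}(U_Q) = ℚ`; generator
`1/(1 + x₀⋯x_n)` with cube integral `η(n+1) = (1 − 2^{−n})·ζ(n+1)`: `π²/12`, `(3/4)ζ(3)`, `(7/8)ζ(4)`, …): the pure-diagonal
functional `diagAltm q₀ P = Σ_i p_{(i,…,i)} (−q₀)^i`; UNIFORM constructive half kernel-checked — `monomial_mem_ex0m`: a monomial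
with non-constant exponent vector is `s = 0`-exact (potentials `α_j x_j x^d`, `Σα_j = 0`, `Σα_j d_j = 1`, by Euler's identity),
`sub_C_diagAltm_mem : P − C(diagAltm q₀ P) ∈ Ex0m Q` for every `P`, `drExact_fermatHyperbolic`; through v2:
`fermatHyperbolic_single_of_singleAt : SingleAt n → (26322 for [ [0,1]^{n+1}, P/(q₀ + ∏xᵢ) ] with functional 0)` (one-step
reduction, all n), `fermatHyperbolic_two_mem_relations` (m = 2 DECIDED, N = 0), **`fermatHyperbolic_three_of_dimTwo`** (m = 3, the
`ζ(3)` denominator `1 + xyz`: `Σ_k p_kkk(−q₀)^k = 0` ⟹ 26322's conclusion GIVEN `DimTwoRationalStratum`), residual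
`FermatHyperbolicResidual n q₀` + PROVED split `fermatHyperbolic_single_of_residual (ih : SingleAt n)`. So on `1 + xyz` the item is
«`a·(3/4)ζ(3) + (weight ≤ 2 cube periods) = 0`, `a ∈ ℚˣ` ⟹ derivable» modulo the m = 2 stratum — ζ(3)'s irrationality (Apéry) is
not enough to make this vacuous; it is exactly a weight-3 instance of the period conjecture's injectivity.
§10 (v6) TRANSPORT KIT + x-LINEAR CLASS: exactness certificates are transported along ANY polynomial substitution
`φ = aeval f` — `drExact_transport : DRExact P Q → DRExact (φP·Jac f) (φQ)` (chain rule `pderiv_aeval_eq_sum`, `pderiv_comm`;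
pulled-back potentials written out), specialised to shears `x ↦ x + A(y)` (`drExact_shear`, Jacobian 1) and permutations
(`drExact_rename_equiv`, from Mathlib's `pderiv_rename`). Consequence: the hyperbola class of §8 is carried onto EVERY x-linear
denominator with leading coefficient `c·y`, `Q = c·(a₀ + (x + A₁(y))·y)` (`drExact_xlin`, functional `P ↦ diagAlt a₀ (P(x − A₁(y), y))`;
`xlin_two_mem_relations` m = 2 DECIDED N = 0; `XLinResidual c a₀ A₀` + PROVED split `xlin_single_of_residual`; swapped orientation
`drExact_ylin`). Census coverage (census-m2-v1, 996-`Q` box): ALL SIX denominators of the `π²` value class (`1+xy`, `1−x+x²+2xy`,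
`1−x+x²+xy`, `1+2xy+y²`, `1+xy+y²`, `1+y+xy+y²`) and the `B = y` dilogarithm classes (`1+y+xy`, `2+y+xy`) are of this shape, so on
each of them 26322 is now «codimension-one class DECIDED (N = 0) + one rational parameter» with the functional in closed form
(§10b: `(x+y)/(1+xy+y²)` and `(x²−2)/(1+xy+y²)` exact, `1/(1+xy+y²)` the generator).
§11 (v7) TRANSLATED SHEARS `(x, y) ↦ (x + A₁(y), y + β)` (`drExact_shearT`, `shearT_unshearT`, helper `evalAt A₀ t = A₀(t)`):
the hyperbola is carried onto the IRREDUCIBLE x-linear class `Q = c·(a₀ + (x + A₁(y))(y + β))` = every `B(y)x + A(y)` with `deg B = 1`,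
`A(−β) ≠ 0` (`drExact_xlinT`, functional `diagAlt a₀ (P(x − A₁(y−β), y−β)/c)`; `xlinT_two_mem_relations` DECIDED N = 0; `XLinTResidual`
+ split), and the grid of §7 onto the REDUCIBLE class `Q = c·(x + A₁(y))(y + β)` (line × graph, `A(−β) = 0`; `drExact_lineGraph`, functional
= `P(−A₁(−β), −β)/c`, the unsheared numerator at the origin; `lineGraph_two_mem_relations` DECIDED N = 0; `LineGraphResidual` + split).
With §6 (`deg B = 0`: everything exact) this CLASSIFIES every denominator `B(y)x + A(y)` with `deg B ≤ 1` — hence EVERY `Q` of the census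
box (total degree ≤ 2) of `x`-degree ≤ 1 or (swap) `y`-degree ≤ 1: decided codim ≤ 1 class + at most one rational parameter. §11b: census rows
`1+2x+2y+2xy+y² = 2(x + (1+y)/2)(y+1)` (corner functional `P(0,−1)/2`: `y+1 ↦ 0`, `1 ↦ 1/2`) and `2+y+xy` (`xy − x + 2 ↦ 0`).
What is left in the box: the conics of bidegree (2,2)-type (`x²` and `y²` both present) — `NonExactKernelGeTwo`, pointer 0096.
§12 (v8) GENERAL AFFINE TRANSPORT `σ = (ax + by + e, cx + dy + e')`, `Δ = ad − bc ≠ 0` (`affMap`, `affInv`, `jac_affMap = C Δ`,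
`drExact_affine`, `aff_unaff : σ ∘ σ⁻¹ = id`, `eq_aff_unaff`): the three base classes spread over the plane —
AFFINE GRAPHS `Q = k·(L₁ + A₀(L₂))` (independent affine forms; contains every PARABOLA-type conic `(αx+βy)² + γx + δy + ε`, `(γ,δ) ∦ (α,β)`):
EVERY numerator exact, 26322 DECIDED outright (`drExact_affineGraph`, `affineGraph_two_mem_relations`, N = 0, no residual);
SPLIT CONICS `Q = k·(a₀ + L₁L₂)` (quadratic part split over `ℚ`): functional `diagAlt a₀ ∘ σ⁻¹`, `splitConic_two_mem_relations` DECIDED N = 0,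
`SplitConicResidual` + split; LINE PAIRS `Q = k·L₁L₂`: functional `P(L₁ ∩ L₂)`, `linePair_two_mem_relations` DECIDED N = 0, `LinePairResidual`
+ split. §12b: `(x+y)² + x + 1` is an affine graph (all numerators decided); on `1 + x² − y²` the numerators `x`, `x² + y²` are exact, `1 ↦ 1`.
What is left in the box after §12: conics whose quadratic part is IRREDUCIBLE over `ℚ` (no rational point at infinity: `x² + y²`, `x² + xy + y²`,
`2x² + 2xy + y²`, `x² − 2y²`, … — the Serret `π·log 2`, Catalan and `log`-of-surd classes) — `NonExactKernelGeTwo`, pointer 0096.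
§13 (v9) NORM-FORM CONICS `Q = k·(a₀ + L₁² − D·L₂²)`, `D ≠ 0` NOT assumed square — EVERY rank-2 conic, incl. those irreducible over `ℚ`:
the infinitesimal automorphism `L = D v∂_u + u∂_v` gives `L h ∈ Ex0` (`lie_mem`), the HOP relations (`hop_mem`, `hop0_mem`, `hop1_mem`) and
with `Q̃·u^n ∈ Ex0` the recursion `(n+2)u^{n+2} ≡ −(n+1)a₀ u^n`; so every monomial ≡ `lam a₀ D i j · 1` (`upow`, `lam`: explicit rational
recursions; `X0_pow_sub_C_mem`, `normMonomial_sub_C_mem`) and the `ℚ`-RATIONAL functional `normAlt a₀ D` (§8's light-cone `diagAlt` descended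
from `ℚ(√D)` to `ℚ`) satisfies `sub_C_normAlt_mem : P − normAlt(P)·1 ∈ Ex0`; `drExact_normConic`, `drExact_conic` (affine transport),
`conic_two_mem_relations` DECIDED N = 0, `ConicResidual` + PROVED split `conic_single_of_residual`. §13b: Serret `1 − 2x + 2x² + 2xy + y²
= (x+y)² + (x−1)²` (`a₀ = 0`, `D = −1`): `x + y ↦ 0` (exact, decided), `1 ↦ 1` (the `π·log 2` generator); `1 + x² + y²`: `x² − y² ↦ 0`, `x² + y² ↦ −1`.
CLASSIFICATION COMPLETE FOR TOTAL DEGREE ≤ 2 (the whole census box): quadratic part of rank 0 / `x`- or `y`-degree ≤ 1 → §6/§10/§11;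
rank 1 → §12 affine graph or v1 cylinder (ALL numerators decided); rank 2 → §13 (split or not; §12 gives the simpler functionals when split):
on EVERY `Q ∈ ℚ[x,y]` of degree ≤ 2, 26322 is DECIDED (N = 0) on an explicit codimension-≤-1 subspace of numerators and the residual is at most
ONE rational parameter per `Q` (the period of `1/Q` over the square: `π²/12`, `π·log 2/8`, `G`, `Li₂`, `log`-surd values, …).
§14 (v10) THE CODIMENSION-ONE THEOREM AS ONE LEAN STATEMENT: `CodimOne Q :⟺ ∃ Λ : ℚ[x,y] →ₗ[ℚ] ℚ, ∀ P, DRExact (P − Λ P·1) Q`, stable under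
`Q ↦ k·Q` (`drExact_C_mul`) and `AGL₂(ℚ)` (`codimOne_affine`, `Λ ∘ σ⁻¹`); completing the square over `ℚ` assembles §6/§8/§12/§13 + cylinders into
**`codimOne_degTwo : ∀ α β γ δ ε ζ, CodimOne (ζ + δx + εy + αx² + βxy + γy²)`** and, via the coefficient extraction `eq_conicQ_of_totalDegree_le_two`,
**`codimOne_of_totalDegree_le_two : ∀ Q, Q.totalDegree ≤ 2 → CodimOne Q`**; for the route **`totalDegree_le_two_decided`**: for EVERY `Q` of
total degree ≤ 2 one `ℚ`-linear `Λ` with (a) `Λ P = 0` + zero-free + value 0 ⟹ `[ [0,1]², P/Q ] ∈ relations` (26322 DECIDED, N = 0) and (b) the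
PROVED split 26322-on-`Q` ⟸ the one-parameter residual `Λ P ≠ 0` (also `degTwo_two_mem_relations`, `degTwo_single_of_residual` in coefficients).
§15 (v11) BRIESKORN–PHAM DENOMINATORS `Q = c + α x^{p+1} + β y^{q+1}` (`α, β ≠ 0`; EVERY degree): the Hamiltonian field of the quasi-homogeneous
part gives the Poisson relations `ham_mem` (`H h ∈ Ex0`), HOP `hopBP_mem`, the box edges `x^p y^j ≡ 0 ≡ x^i y^q` (`boxX_mem`, `boxY_mem`) and with
`Q·h ≡ 0` the two DESCENTS (`descX_mem`, `descY_mem`; explicit rational factors `kx`, `ky` with denominators `S(i,j) = (i+1)(q+1) + (j+1)(p+1)`):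
every monomial ≡ `bpK(i,j)·x^{i mod (p+1)} y^{j mod (q+1)}` (`bpMon_sub_C_mul_mem`), the linear BOX REDUCTION `bpRed` (supported on `i < p, j < q`:
`coeff_bpRed_eq_zero`) satisfies **`sub_bpRed_mem : P − bpRed P ∈ Ex0 Q`**, hence **`bp_codim_le`: p·q explicit functionals (the MILNOR NUMBER of
`αx^{p+1} + βy^{q+1}` = rank H¹ of the Milnor fibre) whose common kernel is exact** — conics `1`, ELLIPTIC `c + αx³ + βy²` → `2`, Fermat cubics → `4`;
for the route `bp_two_mem_relations` (26322 DECIDED, N = 0, on `bpRed P = 0`) and the PROVED split `bp_single_of_residual` (`BPResidual`, p·q parameters).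
§15b: over `1 + x³ + y²`: `y² ↦ −3/5`, `x ↦ x`, `x² ↦ 0`; over `1 + x³ + y³`: `x³ ↦ −1/2`.
§16 (v12) THE BRIESKORN MODULE, EVERY `Q`: the Poisson bracket `pb Q h = Q_x h_y − Q_y h_x` satisfies **`pb_mem : pb Q h ∈ Ex0 Q` for all `Q`, `h`**
(potentials `(−Q_y h, Q_x h)`, `pderiv_comm`); `Brieskorn Q := span (Q·ℚ[x,y] ∪ {Q, ℚ[x,y]})` (= image of `t·H″ + dQ∧dΩ⁰`), **`brieskorn_le_ex0`**, `drExact_of_brieskorn`;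
the earlier fields are instances (`pb_normQ`, `pb_bpQ`, `pb_hypQ`); for the route **`brieskorn_two_mem_relations`** (26322 DECIDED, N = 0, on the Brieskorn module of
EVERY denominator) and the PROVED split of the whole m = 2 slice **`two_single_of_brieskornResidual : (∀ Q, BrieskornResidual Q) → 26322|_{m=2}`** — SPECIAL = Brieskorn
module, GENERIC = the quotient `ℚ[x,y]/Brieskorn Q` (dimension `μ(Q)` for tame `Q`; §8/§13/§14/§15 are explicit splittings: `≤ 1` in degree ≤ 2, `pq` for Brieskorn–Pham).
-/

noncomputable section

open MeasureTheory Set MvPolynomial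
open Literature.NumberTheory.Transcendental
open Literature.NumberTheory.Transcendental.KZ

namespace Summit.KontsevichZagierPeriods.RootDecompRationalCubeDichotomy.Rung26322.RankDescent

variable {M : ℕ}

/-! ## §0 Constant rational vector fields `D_v = Σ_k v_k ∂_k` on `ℚ[x_0,…,x_{M-1}]` -/

/-- The constant vector field `D_v = Σ_k v_k ∂/∂x_k` acting on `ℚ[x]`. [folklore] -/
def dirD (v : Fin M → ℚ) : MvPolynomial (Fin M) ℚ →ₗ[ℚ] MvPolynomial (Fin M) ℚ :=
  ∑ k, v k • (pderiv k : Derivation ℚ (MvPolynomial (Fin M) ℚ) (MvPolynomial (Fin M) ℚ)).toLinearMap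

/-- Auxiliary step `dirD_apply` (§0): dir D apply. [bookkeeping] -/
theorem dirD_apply (v : Fin M → ℚ) (P : MvPolynomial (Fin M) ℚ) :
    dirD v P = ∑ k, v k • pderiv k P := by
  simp [dirD, LinearMap.sum_apply, LinearMap.smul_apply]

/-- Leibniz rule. [folklore] -/
theorem dirD_mul (v : Fin M → ℚ) (P Q : MvPolynomial (Fin M) ℚ) :
    dirD v (P * Q) = dirD v P * Q + P * dirD v Q := by
  simp only [dirD_apply, Derivation.leibniz, smul_eq_mul, MvPolynomial.smul_eq_C_mul, Finset.sum_mul,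
    Finset.mul_sum, ← Finset.sum_add_distrib]
  refine Finset.sum_congr rfl fun k _ => ?_
  ring

/-- Auxiliary step `dirD_C` (§0): dir D C. [bookkeeping] -/
theorem dirD_C (v : Fin M → ℚ) (a : ℚ) : dirD v (C a) = 0 := by
  simp [dirD_apply]

/-- Auxiliary step `dirD_X` (§0): dir D X. [bookkeeping] -/
theorem dirD_X (v : Fin M → ℚ) (k : Fin M) : dirD v (X k) = C (v k) := by
  rw [dirD_apply, Finset.sum_eq_single k]
  · rw [pderiv_X_self, MvPolynomial.smul_eq_C_mul, mul_one]
  · intro j _ hjk; rw [pderiv_X_of_ne (Ne.symm hjk), smul_zero]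
  · intro h; exact absurd (Finset.mem_univ k) h

/-- `D_v` through a univariate profile: `D_v (Q₁(ℓ)) = Q₁'(ℓ) · D_v ℓ`. [folklore] -/
theorem dirD_polynomial_aeval (v : Fin M → ℚ) (ℓ : MvPolynomial (Fin M) ℚ) (Q₁ : Polynomial ℚ) :
    dirD v (Polynomial.aeval ℓ Q₁) = Polynomial.aeval ℓ (Polynomial.derivative Q₁) * dirD v ℓ := by
  simp only [dirD_apply, Derivation.map_aeval, smul_eq_mul, MvPolynomial.smul_eq_C_mul, Finset.mul_sum]
  refine Finset.sum_congr rfl fun k _ => ?_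
  ring

/-- `D_v` of a monomial. [folklore] -/
theorem dirD_monomial (v : Fin M → ℚ) (s : Fin M →₀ ℕ) (a : ℚ) :
    dirD v (monomial s a) = ∑ k, monomial (s - Finsupp.single k 1) (v k * (a * s k)) := by
  rw [dirD_apply]
  refine Finset.sum_congr rfl fun k _ => ?_
  rw [pderiv_monomial, smul_monomial, smul_eq_mul]

/-- Evaluation of `D_v P` at a real point. [folklore] -/
theorem aeval_dirD (v : Fin M → ℚ) (P : MvPolynomial (Fin M) ℚ) (x : Fin M → ℝ) :
    aeval x (dirD v P) = ∑ k, (v k : ℝ) * aeval x (pderiv k P) := by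
  rw [dirD_apply, map_sum]
  refine Finset.sum_congr rfl fun k _ => ?_
  rw [MvPolynomial.smul_eq_C_mul, map_mul, MvPolynomial.aeval_C, eq_ratCast]

/-- The off-`j` degree `Σ_{k ≠ j} e_k` of an exponent vector. [folklore] -/
def offDeg (j : Fin M) (e : Fin M →₀ ℕ) : ℕ := ∑ k ∈ Finset.univ.erase j, e k

/-- The exponent `e + 1_j - 1_k`. [folklore] -/
def shiftExp (e : Fin M →₀ ℕ) (j k : Fin M) : Fin M →₀ ℕ := e + Finsupp.single j 1 - Finsupp.single k 1

/-- Auxiliary step `shiftExp_apply` (§0): shift Exp apply. [bookkeeping] -/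
theorem shiftExp_apply (e : Fin M →₀ ℕ) (j k i : Fin M) :
    shiftExp e j k i = e i + (Finsupp.single j 1 : Fin M →₀ ℕ) i - (Finsupp.single k 1 : Fin M →₀ ℕ) i := by
  simp only [shiftExp, Finsupp.tsub_apply, Finsupp.add_apply]

/-- Auxiliary step `shiftExp_self` (§0): shift Exp self. [bookkeeping] -/
theorem shiftExp_self (e : Fin M →₀ ℕ) (j : Fin M) : shiftExp e j j = e := by
  ext i
  rw [shiftExp_apply]
  omega

end Summit.KontsevichZagierPeriods.RootDecompRationalCubeDichotomy.Rung26322.RankDescent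
end
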